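import Mathlib
import HarnessLib

/-!
# PCINT lane, PHASE 5 (block-renewal second moment), step 1: the lazy three-point walk

Cell `prim-pcint`, seat `prim-pcint-1` (gen 14); memo `run/shared/lean/prim/pcint/T-FIBRE-ROUTE.md` §PHASE 5.

PHASE 5 bounds `p_c(ℤ^d)` from above by a second-moment argument for BLOCK paths (one step along a time axis per
block, preceded by a coordinate-monotone transverse piece) whose pair-offset performs, coordinate by coordinate, a
lazy symmetric three-point random walk.  This file is the one-dimensional input: for `0 < s ≤ 1` the law
`g₃ s` on `{-1, 0, 1}` (`1 - s/2` at `0`, `s/4` at `±1`) and the closed form of its `N`-fold convolution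

  `F s N δ = Σ_{i+j=N} C(N,i) s^i (1-s)^j · C(2i, i+δ) / 4^i`

(`BSM.F`; the walk is a fair `±`coin-difference performed at a `Bernoulli(s)`-thinned set of times).  Results: the
one-step recursion `BSM.F_succ` (`F (N+1) δ = Σ_c g₃(c) F N (δ - c)`), monotonicity in the target `BSM.F_le_F_zero`
(`F N δ ≤ F N 0`, from `C(2i, i+δ) ≤ C(2i, i)`), and the decay **`BSM.F_zero_sq_le`**: `F N 0 ² ≤ 1 / ((N+1) s)`
(Cauchy–Schwarz over the thinning level `i`, the central binomial bound `C(2i,i)² (3i+1) ≤ 16^i`, and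
`Σ_i C(N,i) s^i (1-s)^{N-i} / (i+1) ≤ 1/((N+1)s)`).  Everything is elementary and finite.
-/

noncomputable section

namespace Summit.CriticalPhenomena.PercolationContinuityZ3.Theorems.Pcint.BSM

open Finset

/-! ### Integer-indexed binomial coefficients -/

/-- `chooseZ n m = C(n, m)` for an integer lower index (`0` when `m < 0`). -/
def chooseZ (n : ℕ) (m : ℤ) : ℕ := if 0 ≤ m then n.choose m.toNat else 0

/-- At natural indices `chooseZ` is `Nat.choose`. -/
theorem chooseZ_natCast (n k : ℕ) : chooseZ n (k : ℤ) = n.choose k := by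
  simp [chooseZ]

/-- Negative indices give `0`. -/
theorem chooseZ_of_neg (n : ℕ) {m : ℤ} (hm : m < 0) : chooseZ n m = 0 := by
  simp [chooseZ, not_le.2 hm]

/-- **Pascal's rule** for all integer indices. -/
theorem chooseZ_succ (n : ℕ) (m : ℤ) : chooseZ (n + 1) m = chooseZ n (m - 1) + chooseZ n m := by
  unfold chooseZ
  rcases lt_trichotomy m 0 with h | rfl | h
  · rw [if_neg (not_le.2 h), if_neg (by omega), if_neg (not_le.2 h)]
  · simp
  · have hm1 : (0 : ℤ) ≤ m - 1 := by omega
    rw [if_pos h.le, if_pos hm1, if_pos h.le]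
    have : m.toNat = (m - 1).toNat + 1 := by omega
    rw [this, Nat.choose_succ_succ]

/-- `C(2i, i + δ) ≤ C(2i, i)`. -/
theorem chooseZ_two_mul_le (i : ℕ) (δ : ℤ) : chooseZ (2 * i) ((i : ℤ) + δ) ≤ (2 * i).choose i := by
  unfold chooseZ
  split_ifs with h
  · have := Nat.choose_le_middle ((i : ℤ) + δ).toNat (2 * i)
    rwa [Nat.mul_div_cancel_left i (by norm_num)] at this
  · exact Nat.zero_le _

/-- `chooseZ (2i) (i + 0) = C(2i, i)`. -/
theorem chooseZ_two_mul_self (i : ℕ) : chooseZ (2 * i) ((i : ℤ) + 0) = (2 * i).choose i := by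
  rw [add_zero, chooseZ_natCast]

/-! ### The three-point law and the closed form -/

/-- The value `c - 1 ∈ {-1, 0, 1}` of a letter `c : Fin 3`. -/
def val (c : Fin 3) : ℤ := (c : ℤ) - 1

/-- **The lazy three-point law** `g₃ s`: mass `1 - s/2` at `0` (the letter `1`) and `s/4` at `±1`. -/
def g₃ (s : ℝ) (c : Fin 3) : ℝ := if c = 1 then 1 - s / 2 else s / 4

/-- The normalised central-type coefficient `C(2i, i+δ)/4^i`. -/
def cc (i : ℕ) (δ : ℤ) : ℝ := (chooseZ (2 * i) ((i : ℤ) + δ) : ℝ) / 4 ^ i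

/-- **The closed form** `F s N δ = Σ_{i+j=N} C(N,i) s^i (1-s)^j C(2i,i+δ)/4^i` of the `N`-fold convolution of `g₃ s`
evaluated at `δ`. -/
def F (s : ℝ) (N : ℕ) (δ : ℤ) : ℝ :=
  ∑ ij ∈ antidiagonal N, (N.choose ij.1 : ℝ) * s ^ ij.1 * (1 - s) ^ ij.2 * cc ij.1 δ

/-- `cc 0 δ = 𝟙[δ = 0]`. -/
theorem cc_zero (δ : ℤ) : cc 0 δ = if δ = 0 then 1 else 0 := by
  unfold cc chooseZ
  simp only [Nat.mul_zero, Nat.cast_zero, zero_add, pow_zero, div_one]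
  by_cases h : δ = 0
  · subst h; simp
  · rw [if_neg h]
    split_ifs with h0
    · have hne : δ.toNat ≠ 0 := by omega
      obtain ⟨k, hk⟩ := Nat.exists_eq_succ_of_ne_zero hne
      rw [hk, Nat.choose_zero_succ]; simp
    · simp

/-- `cc ≥ 0`. -/
theorem cc_nonneg (i : ℕ) (δ : ℤ) : 0 ≤ cc i δ := by unfold cc; positivity

/-- **Recursion of `cc`**: `cc (i+1) δ = (cc i (δ-1) + 2 cc i δ + cc i (δ+1)) / 4` (Pascal's rule twice). -/
theorem cc_succ (i : ℕ) (δ : ℤ) : cc (i + 1) δ = (cc i (δ - 1) + 2 * cc i δ + cc i (δ + 1)) / 4 := by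
  unfold cc
  have h2 : 2 * (i + 1) = 2 * i + 1 + 1 := by ring
  rw [h2, chooseZ_succ, chooseZ_succ (2 * i), chooseZ_succ (2 * i)]
  have e1 : ((i + 1 : ℕ) : ℤ) + δ - 1 - 1 = (i : ℤ) + (δ - 1) := by push_cast; ring
  have e2 : ((i + 1 : ℕ) : ℤ) + δ - 1 = (i : ℤ) + δ := by push_cast; ring
  have e3 : ((i + 1 : ℕ) : ℤ) + δ = (i : ℤ) + (δ + 1) := by push_cast; ring
  rw [e1, e2, e3]
  push_cast
  rw [pow_succ]
  ring

/-- `F s 0 δ = 𝟙[δ = 0]`. -/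
theorem F_zero (s : ℝ) (δ : ℤ) : F s 0 δ = if δ = 0 then 1 else 0 := by
  unfold F
  rw [Finset.Nat.antidiagonal_zero, sum_singleton]
  simp [cc_zero]

/-- **The one-step recursion** in closed form:
`F s (N+1) δ = (1 - s/2) F s N δ + (s/4) (F s N (δ-1) + F s N (δ+1))`. -/
theorem F_succ (s : ℝ) (N : ℕ) (δ : ℤ) :
    F s (N + 1) δ = (1 - s / 2) * F s N δ + s / 4 * (F s N (δ - 1) + F s N (δ + 1)) := by
  -- split `C(N+1, i+1) = C(N, i) + C(N, i+1)` after peeling the `i = 0` term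
  have step1 : F s (N + 1) δ =
      (∑ ij ∈ antidiagonal (N + 1), (N.choose ij.1 : ℝ) * s ^ ij.1 * (1 - s) ^ ij.2 * cc ij.1 δ) +
        ∑ ij ∈ antidiagonal N, (N.choose ij.1 : ℝ) * s ^ (ij.1 + 1) * (1 - s) ^ ij.2 * cc (ij.1 + 1) δ := by
    unfold F
    rw [Finset.Nat.sum_antidiagonal_succ, Finset.Nat.sum_antidiagonal_succ]
    simp only [Nat.choose_zero_right, Nat.choose_succ_succ, Nat.cast_add, Nat.cast_one]
    rw [add_assoc, ← sum_add_distrib]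
    congr 1
    refine sum_congr rfl fun ij _ => ?_
    ring
  -- the first sum is `(1 - s) F N δ`
  have step2 : ∑ ij ∈ antidiagonal (N + 1), (N.choose ij.1 : ℝ) * s ^ ij.1 * (1 - s) ^ ij.2 * cc ij.1 δ =
      (1 - s) * F s N δ := by
    rw [Finset.Nat.sum_antidiagonal_succ']
    simp only [Nat.choose_succ_self, Nat.cast_zero, zero_mul, zero_add]
    unfold F
    rw [mul_sum]
    refine sum_congr rfl fun ij _ => ?_
    rw [pow_succ]
    ring
  -- the second is `s (F N (δ-1) + 2 F N δ + F N (δ+1)) / 4`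
  have step3 : ∑ ij ∈ antidiagonal N, (N.choose ij.1 : ℝ) * s ^ (ij.1 + 1) * (1 - s) ^ ij.2 * cc (ij.1 + 1) δ =
      s / 4 * (F s N (δ - 1) + 2 * F s N δ + F s N (δ + 1)) := by
    unfold F
    rw [mul_sum, ← sum_add_distrib, ← sum_add_distrib, mul_sum]
    refine sum_congr rfl fun ij _ => ?_
    rw [cc_succ, pow_succ]
    ring
  rw [step1, step2, step3]
  ring

/-- `F ≥ 0` for `0 ≤ s ≤ 1`. -/
theorem F_nonneg {s : ℝ} (hs0 : 0 ≤ s) (hs1 : s ≤ 1) (N : ℕ) (δ : ℤ) : 0 ≤ F s N δ := by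
  unfold F
  refine sum_nonneg fun ij _ => ?_
  have : 0 ≤ 1 - s := by linarith
  exact mul_nonneg (mul_nonneg (mul_nonneg (by positivity) (pow_nonneg hs0 _)) (pow_nonneg this _)) (cc_nonneg _ _)

/-- **Monotonicity in the target**: `F s N δ ≤ F s N 0`. -/
theorem F_le_F_zero {s : ℝ} (hs0 : 0 ≤ s) (hs1 : s ≤ 1) (N : ℕ) (δ : ℤ) : F s N δ ≤ F s N 0 := by
  unfold F
  refine sum_le_sum fun ij _ => ?_
  have ht : 0 ≤ 1 - s := by linarith
  refine mul_le_mul_of_nonneg_left ?_ (mul_nonneg (mul_nonneg (by positivity) (pow_nonneg hs0 _)) (pow_nonneg ht _))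
  unfold cc
  refine div_le_div_of_nonneg_right ?_ (by positivity)
  rw [chooseZ_two_mul_self]
  exact_mod_cast chooseZ_two_mul_le ij.1 δ

/-! ### The decay of the return probability -/

/-- **Central binomial bound**: `C(2i, i)² · (3i + 1) ≤ 16^i`. -/
theorem centralBinom_sq_mul_le (i : ℕ) : (Nat.centralBinom i) ^ 2 * (3 * i + 1) ≤ 16 ^ i := by
  induction i with
  | zero => simp [Nat.centralBinom_zero]
  | succ i ih =>
    -- `(i+1) C_{i+1} = 2 (2i+1) C_i`
    have hrec := Nat.succ_mul_centralBinom_succ i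
    have key : (i + 1) ^ 2 * ((Nat.centralBinom (i + 1)) ^ 2 * (3 * (i + 1) + 1)) ≤ (i + 1) ^ 2 * 16 ^ (i + 1) := by
      have e : (i + 1) ^ 2 * ((Nat.centralBinom (i + 1)) ^ 2 * (3 * (i + 1) + 1)) =
          ((i + 1) * Nat.centralBinom (i + 1)) ^ 2 * (3 * i + 4) := by ring
      rw [e, hrec]
      have poly : (2 * (2 * i + 1)) ^ 2 * (3 * i + 4) ≤ 16 * ((i + 1) ^ 2 * (3 * i + 1)) := by nlinarith
      calc (2 * (2 * i + 1) * Nat.centralBinom i) ^ 2 * (3 * i + 4)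
          = (2 * (2 * i + 1)) ^ 2 * (3 * i + 4) * (Nat.centralBinom i) ^ 2 := by ring
        _ ≤ 16 * ((i + 1) ^ 2 * (3 * i + 1)) * (Nat.centralBinom i) ^ 2 := Nat.mul_le_mul_right _ poly
        _ = (i + 1) ^ 2 * (16 * ((Nat.centralBinom i) ^ 2 * (3 * i + 1))) := by ring
        _ ≤ (i + 1) ^ 2 * (16 * 16 ^ i) := Nat.mul_le_mul_left _ (Nat.mul_le_mul_left _ ih)
        _ = (i + 1) ^ 2 * 16 ^ (i + 1) := by rw [pow_succ]; ring
    exact Nat.le_of_mul_le_mul_left key (by positivity)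

/-- `cc i 0 ² ≤ 1 / (i + 1)`. -/
theorem cc_zero_sq_le (i : ℕ) : cc i 0 ^ 2 ≤ 1 / ((i : ℝ) + 1) := by
  unfold cc
  rw [chooseZ_two_mul_self, ← Nat.centralBinom.eq_1, div_pow, ← pow_mul, show (4 : ℝ) ^ (i * 2) = 16 ^ i by
    rw [mul_comm, pow_mul]; norm_num]
  have h := centralBinom_sq_mul_le i
  have h' : ((Nat.centralBinom i : ℝ)) ^ 2 * (3 * i + 1) ≤ 16 ^ i := by exact_mod_cast h
  rw [div_le_div_iff₀ (by positivity) (by positivity), one_mul]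
  nlinarith [sq_nonneg ((Nat.centralBinom i : ℝ))]

/-- The binomial weights sum to one: `Σ_{i+j=N} C(N,i) s^i (1-s)^j = 1`. -/
theorem sum_binomial_weights (s : ℝ) (N : ℕ) :
    ∑ ij ∈ antidiagonal N, (N.choose ij.1 : ℝ) * s ^ ij.1 * (1 - s) ^ ij.2 = 1 := by
  have h := add_pow s (1 - s) N
  rw [show s + (1 - s) = 1 by ring, one_pow] at h
  rw [Finset.Nat.sum_antidiagonal_eq_sum_range_succ_mk]
  conv_rhs => rw [h]
  exact sum_congr rfl fun i _ => by ring

/-- `Σ_{i+j=N} C(N,i) s^i (1-s)^j / (i+1) ≤ 1 / ((N+1) s)` for `0 < s ≤ 1`. -/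
theorem sum_binomial_weights_div_le {s : ℝ} (hs0 : 0 < s) (hs1 : s ≤ 1) (N : ℕ) :
    ∑ ij ∈ antidiagonal N, (N.choose ij.1 : ℝ) * s ^ ij.1 * (1 - s) ^ ij.2 / ((ij.1 : ℝ) + 1) ≤
      1 / (((N : ℝ) + 1) * s) := by
  have ht : 0 ≤ 1 - s := by linarith
  -- `(N+1) s · term(i,j) = C(N+1, i+1) s^{i+1} (1-s)^j`
  have key : ((N : ℝ) + 1) * s *
      ∑ ij ∈ antidiagonal N, (N.choose ij.1 : ℝ) * s ^ ij.1 * (1 - s) ^ ij.2 / ((ij.1 : ℝ) + 1) =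
      ∑ ij ∈ antidiagonal N, ((N + 1).choose (ij.1 + 1) : ℝ) * s ^ (ij.1 + 1) * (1 - s) ^ ij.2 := by
    rw [mul_sum]
    refine sum_congr rfl fun ij _ => ?_
    have hnat : ((N : ℝ) + 1) * (N.choose ij.1 : ℝ) = ((N + 1).choose (ij.1 + 1) : ℝ) * ((ij.1 : ℝ) + 1) := by
      have := Nat.add_one_mul_choose_eq N ij.1
      exact_mod_cast this
    have hi : (0 : ℝ) < (ij.1 : ℝ) + 1 := by positivity
    rw [mul_div_assoc', div_eq_iff hi.ne', pow_succ]
    calc ((N : ℝ) + 1) * s * ((N.choose ij.1 : ℝ) * s ^ ij.1 * (1 - s) ^ ij.2)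
        = (((N : ℝ) + 1) * (N.choose ij.1 : ℝ)) * (s ^ ij.1 * s) * (1 - s) ^ ij.2 := by ring
      _ = (((N + 1).choose (ij.1 + 1) : ℝ) * ((ij.1 : ℝ) + 1)) * (s ^ ij.1 * s) * (1 - s) ^ ij.2 := by rw [hnat]
      _ = ((N + 1).choose (ij.1 + 1) : ℝ) * (s ^ ij.1 * s) * (1 - s) ^ ij.2 * ((ij.1 : ℝ) + 1) := by ring
  -- and that sum is `1 - (1-s)^{N+1} ≤ 1`
  have hle : ∑ ij ∈ antidiagonal N, ((N + 1).choose (ij.1 + 1) : ℝ) * s ^ (ij.1 + 1) * (1 - s) ^ ij.2 ≤ 1 := by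
    have htot := sum_binomial_weights s (N + 1)
    rw [Finset.Nat.sum_antidiagonal_succ] at htot
    simp only [Nat.choose_zero_right, Nat.cast_one, pow_zero, one_mul] at htot
    have : 0 ≤ (1 - s) ^ (N + 1) := pow_nonneg ht _
    linarith
  have hpos : 0 < ((N : ℝ) + 1) * s := by positivity
  rw [le_div_iff₀ hpos, mul_comm]
  calc ((N : ℝ) + 1) * s * ∑ ij ∈ antidiagonal N, (N.choose ij.1 : ℝ) * s ^ ij.1 * (1 - s) ^ ij.2 / ((ij.1 : ℝ) + 1)
      = _ := key
    _ ≤ 1 := hle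

/-- **Decay of the return probability**: `F s N 0 ² ≤ 1 / ((N+1) s)` for `0 < s ≤ 1`. -/
theorem F_zero_sq_le {s : ℝ} (hs0 : 0 < s) (hs1 : s ≤ 1) (N : ℕ) :
    F s N 0 ^ 2 ≤ 1 / (((N : ℝ) + 1) * s) := by
  have ht : 0 ≤ 1 - s := by linarith
  set p : ℕ × ℕ → ℝ := fun ij => (N.choose ij.1 : ℝ) * s ^ ij.1 * (1 - s) ^ ij.2 with hp
  have hp0 : ∀ ij ∈ antidiagonal N, 0 ≤ p ij := fun ij _ =>
    mul_nonneg (mul_nonneg (by positivity) (pow_nonneg hs0.le _)) (pow_nonneg ht _)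
  -- Cauchy–Schwarz: `(Σ p c)² ≤ (Σ p) (Σ p c²)`
  have hcs := sum_sq_le_sum_mul_sum_of_sq_le_mul (antidiagonal N) (r := fun ij => p ij * cc ij.1 0)
    (f := p) (g := fun ij => p ij * cc ij.1 0 ^ 2) hp0 (fun ij hij => mul_nonneg (hp0 ij hij) (sq_nonneg _))
    (fun ij _ => by ring_nf; rfl)
  have hF : F s N 0 = ∑ ij ∈ antidiagonal N, p ij * cc ij.1 0 := rfl
  rw [hF]
  refine hcs.trans ?_
  rw [show ∑ ij ∈ antidiagonal N, p ij = 1 from sum_binomial_weights s N, one_mul]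
  calc ∑ ij ∈ antidiagonal N, p ij * cc ij.1 0 ^ 2
      ≤ ∑ ij ∈ antidiagonal N, p ij / ((ij.1 : ℝ) + 1) := by
        refine sum_le_sum fun ij hij => ?_
        rw [div_eq_mul_one_div]
        exact mul_le_mul_of_nonneg_left (cc_zero_sq_le ij.1) (hp0 ij hij)
    _ ≤ 1 / (((N : ℝ) + 1) * s) := sum_binomial_weights_div_le hs0 hs1 N

/-- **Decay everywhere**: `F s N δ ² ≤ 1 / ((N+1) s)`. -/
theorem F_sq_le {s : ℝ} (hs0 : 0 < s) (hs1 : s ≤ 1) (N : ℕ) (δ : ℤ) :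
    F s N δ ^ 2 ≤ 1 / (((N : ℝ) + 1) * s) := by
  have h0 := F_nonneg hs0.le hs1 N δ
  have h1 := F_le_F_zero hs0.le hs1 N δ
  calc F s N δ ^ 2 ≤ F s N 0 ^ 2 := pow_le_pow_left₀ h0 h1 2
    _ ≤ _ := F_zero_sq_le hs0 hs1 N

/-! ### The recursion in letter form -/

/-- The weights of `g₃`. -/
theorem g₃_apply (s : ℝ) : g₃ s 0 = s / 4 ∧ g₃ s 1 = 1 - s / 2 ∧ g₃ s 2 = s / 4 := by
  refine ⟨?_, ?_, ?_⟩ <;> simp [g₃]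

/-- The values of the letters. -/
theorem val_apply : val 0 = -1 ∧ val 1 = 0 ∧ val 2 = 1 := by
  refine ⟨?_, ?_, ?_⟩ <;> simp [val]

/-- `g₃` is nonnegative for `0 ≤ s ≤ 1`. -/
theorem g₃_nonneg {s : ℝ} (hs0 : 0 ≤ s) (hs1 : s ≤ 1) (c : Fin 3) : 0 ≤ g₃ s c := by
  unfold g₃; split_ifs <;> linarith

/-- `g₃` is a probability vector. -/
theorem sum_g₃ (s : ℝ) : ∑ c : Fin 3, g₃ s c = 1 := by
  simp [Fin.sum_univ_three, g₃]; ring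

/-- **`F (N+1) δ = Σ_c g₃(c) F N (δ - val c)`** (the recursion in letter form). -/
theorem F_succ_sum (s : ℝ) (N : ℕ) (δ : ℤ) : F s (N + 1) δ = ∑ c : Fin 3, g₃ s c * F s N (δ - val c) := by
  rw [F_succ, Fin.sum_univ_three, (g₃_apply s).1, (g₃_apply s).2.1, (g₃_apply s).2.2, val_apply.1, val_apply.2.1,
    val_apply.2.2, sub_neg_eq_add, sub_zero]
  ring

/-- The reflected form: `F (N+1) δ = Σ_c g₃(c) F N (δ + val c)` (the law `g₃` is symmetric). -/
theorem F_succ_sum' (s : ℝ) (N : ℕ) (δ : ℤ) : F s (N + 1) δ = ∑ c : Fin 3, g₃ s c * F s N (δ + val c) := by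
  rw [F_succ, Fin.sum_univ_three, (g₃_apply s).1, (g₃_apply s).2.1, (g₃_apply s).2.2, val_apply.1, val_apply.2.1,
    val_apply.2.2, ← sub_eq_add_neg, add_zero]
  ring

end Summit.CriticalPhenomena.PercolationContinuityZ3.Theorems.Pcint.BSM

end
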